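import Literature.AlgebraicGeometry.HodgeTheory.HeckePrymF21WeilTwelvefold
import Literature.AlgebraicGeometry.HodgeTheory.WeilClassesCyclicPrymDegreeSeven
import HarnessLib

/-!
# The Hecke–Prym of an étale `F₂₁`-cover: the endomorphism (Hecke-algebra) half of `exists_heckePrymDatum_F21`, proved

Topic `AlgebraicGeometry/HodgeTheory`; namespace `Literature.AlgebraicGeometry.HodgeTheory`.
Companion ("Proofs" sibling) of the NAMED FACT
`Literature.AlgebraicGeometry.HodgeTheory.exists_heckePrymDatum_F21` (`HeckePrymF21WeilTwelvefold.lean`):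
an étale Galois `F₂₁ = ⟨σ, τ | σ⁷ = τ³ = 1, τστ⁻¹ = σ²⟩`-cover `C → C'` of a complex genus-3 curve and its
Hecke–Prym `P' = ((ker Σ_{i<7} σ_*ⁱ)⁰)^{τ,0}`, a `ℚ(√-7)`-Weil twelvefold of type `(6,6)`
([LangeRodriguez2022, §3.2 (3.5)–(3.6), §3.5 Cor. 3.5.9–3.5.10]; held:
`book:lange2022-decomposition-jacobians-by-prym-varieties`, PDF pp. 56, 70–71).

The fact is an EXISTENCE statement with three kinds of conjuncts:

1. GEOMETRIC EXISTENCE — a smooth projective complex curve `C` with a Jacobian of dimension `43` and a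
   free action of `F₂₁` (Riemann's existence theorem for the generating vector
   `(a₁, a₂, a₃; b₁, b₂, b₃) = (σ, τ, 1; 1, 1, 1)` of type `(3; —)`, [LangeRodriguez2022, Thm. 3.1.1]; existence of Jacobians,
   `Motives.nonempty_jacobian_of_isSmoothProjective`), `dim P' = 12` (Chevalley–Weil, [LangeRodriguez2022,
   §3.5 Cor. 3.5.9]) and a non-zero rational `(6,6)`-class in the Weil plane of `(P', φ')`
   ([vanGeemen1994HodgeAV, Lemma 5.2]) — NOT proved in the tree (no construction of curves with a
   prescribed automorphism group, no Jacobian of a given curve, no Hodge decomposition of `H¹(P')`);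
2. RESTRICTION DATA — the endomorphisms `s = σ_*`, `t = τ_*`, `e_N = Σ_{i<7} sⁱ` of `J`, the restrictions
   `s_B`, `t_B` to `B = (ker e_N)⁰` and `φ' = η_B|_{P'}` of the Hecke element (quadratic Gauss sum)
   `η_B = s_B + s_B² + s_B⁴ - s_B³ - s_B⁵ - s_B⁶` to `P' = (ker(𝟙_B - t_B))⁰`, with their defining equations;
3. THE HECKE RELATION `φ' ∘ φ' = -7`.

This file PROVES (2) and (3) for EVERY curve as in (1) — the "action of the Hecke algebra"
([LangeRodriguez2022, §2.10 and §3.5 (p. 70): `ℚ[H\G/H] = p_H ℚ[G] p_H` acts on `J(C_H)` and on the Pryms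
of intermediate covers]; here `H = ⟨τ⟩`, and the element is the Gauss sum of `N = ⟨σ⟩ ◁ F₂₁`, which is
`τ`-invariant because conjugation by `τ` multiplies exponents by the quadratic residue `2`):

* in any preadditive category, from `s ∘… : s ≫ t = t ≫ s ≫ s` (`τσ = σ²τ` read through the covariant
  `Jacobian.pushforward`) and `s⁷ = 𝟙`: `sᵏ ≫ t = t ≫ s²ᵏ`, hence the norm element `e = Σ_{i<7} sⁱ`
  and the Gauss sum `η = s + s² + s⁴ - s³ - s⁵ - s⁶` COMMUTE with `t`
  (`normElement_comm_of_conj`, `weilOperator_comm_of_conj`: `2·{1,2,4} = {2,4,1}`, `2·{3,5,6} = {6,3,5}`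
  in `ℤ/7`);
* on the Jacobian: `σ ≫ τ = τ ≫ σ ≫ σ` gives `σ_* ≫ τ_* = τ_* ≫ σ_* ≫ σ_*` (`Jacobian.pushforward_comp`);
* on `B = AbelianVariety.kerComponent e_N`: `t` restricts (`t_B`, `exists_kerComponent_restrict_of_conj`),
  any restrictions satisfy `s_B ≫ t_B = t_B ≫ s_B ≫ s_B` (`kerComponent_restrict_conj`, `ι` is mono),
  `s_B⁷ = 𝟙` (`kerComponent_restrict_comp_pow_seven`, degree-7 sibling), so `η_B` commutes with `t_B`
  and with `𝟙 - t_B` and RESTRICTS to `P' = kerComponent (𝟙 - t_B)` (`exists_heckeOperator_restrict`);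
  and EVERY `φ'` over `η_B` has `φ' ≫ φ' = -7` (`heckeOperator_restrict_comp_self`, from the sibling's
  `kerComponent_weilOperator_comp_self_of_cyclotomic₇`, `η_B² = -7`);
* ASSEMBLY MODULO GEOMETRY (`exists_heckePrymDatum_F21_of_geometry`): the named fact follows from its
  geometric conjuncts (1) alone, stated in the fact's own binder shape — the tree-side residue of the
  fact is exactly Riemann existence + Jacobian + `dim P' = 12` + the Weil class.

No new named fact is introduced; nothing here is specific to genus `43` except the assembly.

## References

* [LangeRodriguez2022] H. Lange, R. E. Rodríguez, *Decomposition of Jacobians by Prym Varieties*,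
  LNM 2310 (2022): §2.10 (Hecke algebra action, PDF pp. 47–49), Thm. 3.1.1 (PDF p. 52), §3.2 (3.5)–(3.6)
  (PDF p. 56), §3.5 Prop. 3.5.7, Cor. 3.5.8–3.5.10 (PDF pp. 70–71).
* [Schoen1988HodgeWeil] C. Schoen, Compositio Math. 65 (1988), §3 (p. 24) — `ℤ[√-7] ⊂ ℤ[ζ₇]` on the
  cyclic Prym (the sibling `WeilClassesCyclicPrymDegreeSeven`).
* [Ellenberg2001EndJacobians] J. Ellenberg, Adv. Math. 162 (2001), §1–2 (Hecke endomorphism algebras of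
  Jacobians of Galois covers).
-/

namespace Literature.AlgebraicGeometry.HodgeTheory

open CategoryTheory
open Literature.AlgebraicGeometry Literature.AlgebraicGeometry.Motives
open Literature.AlgebraicTopology.SingularHomology

/-! ### `F₂₁ = ℤ/7 ⋊ ℤ/3` in a preadditive category: `t` normalises `⟨s⟩`, so `e_N` and `η` commute with `t` -/

section FrobeniusTwentyOne

variable {𝒞 : Type*} [Category 𝒞] [Preadditive 𝒞] {X : 𝒞} {s t : X ⟶ X}

omit [Preadditive 𝒞] in
/-- **`sᵏ ≫ t = t ≫ s²ᵏ (mod s⁷ = 𝟙)`** for `k = 2, …, 6`: conjugation by `τ` acts on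
`N = ⟨σ⟩ ≅ ℤ/7` as multiplication by `2` (`τστ⁻¹ = σ²`; covariantly `s ≫ t = t ≫ s ≫ s`). [folklore] -/
theorem comp_pow_comp_eq_of_conj (h7 : s ≫ s ≫ s ≫ s ≫ s ≫ s ≫ s = 𝟙 X) (hst : s ≫ t = t ≫ s ≫ s) :
    s ≫ s ≫ t = t ≫ s ≫ s ≫ s ≫ s ∧ s ≫ s ≫ s ≫ t = t ≫ s ≫ s ≫ s ≫ s ≫ s ≫ s ∧
      s ≫ s ≫ s ≫ s ≫ t = t ≫ s ∧ s ≫ s ≫ s ≫ s ≫ s ≫ t = t ≫ s ≫ s ≫ s ∧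
      s ≫ s ≫ s ≫ s ≫ s ≫ s ≫ t = t ≫ s ≫ s ≫ s ≫ s ≫ s := by
  refine ⟨?_, ?_, ?_, ?_, ?_⟩ <;> simp only [hst, reassoc_of% hst, h7, Category.comp_id]

/-- **The norm element of `N` commutes with `t`**: for `s⁷ = 𝟙`, `s ≫ t = t ≫ s ≫ s` and
`e = 𝟙 + s + ⋯ + s⁶` (`= π^* ∘ Nm_π` for the cyclic subcover `C → C/⟨σ⟩`), `t ≫ e = e ≫ t`
(`k ↦ 2k` permutes `ℤ/7`; `N ◁ F₂₁` so `e_N` is central in `ℤ[F₂₁]`). Consequently `t` restricts to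
`B = (ker e_N)⁰` (`AbelianVariety.kerComponentRestrict`). [folklore] -/
theorem normElement_comm_of_conj (h7 : s ≫ s ≫ s ≫ s ≫ s ≫ s ≫ s = 𝟙 X) (hst : s ≫ t = t ≫ s ≫ s)
    {e : X ⟶ X}
    (he : e = 𝟙 X + s + s ≫ s + s ≫ s ≫ s + s ≫ s ≫ s ≫ s + s ≫ s ≫ s ≫ s ≫ s +
      s ≫ s ≫ s ≫ s ≫ s ≫ s) :
    t ≫ e = e ≫ t := by
  subst he
  -- move `t` to the left (`s ≫ t = t ≫ s ≫ s`), then reduce the exponents modulo `s⁷ = 𝟙`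
  simp only [Preadditive.add_comp, Preadditive.comp_add, Category.id_comp, Category.comp_id,
    Category.assoc, hst, reassoc_of% hst, h7]
  abel

/-- **The Hecke element (quadratic Gauss sum) `η = s + s² + s⁴ - s³ - s⁵ - s⁶` commutes with `t`**:
conjugation by `τ` multiplies exponents by `2`, a quadratic residue mod `7`, so it permutes
`{1, 2, 4}` and `{3, 5, 6}` separately — `η ∈ ℤ[N]^{⟨τ⟩} ⊂ Z(ℤ[F₂₁])`-part acting on the Pryms of
the intermediate covers ([LangeRodriguez2022, §2.10, §3.5 p. 70]). [cite: LangeRodriguez2022, §2.10 and §3.5 (Cor. 3.5.8–3.5.9, PDF p. 70)] -/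
theorem weilOperator_comm_of_conj (h7 : s ≫ s ≫ s ≫ s ≫ s ≫ s ≫ s = 𝟙 X) (hst : s ≫ t = t ≫ s ≫ s)
    {η : X ⟶ X}
    (hη : η = s + s ≫ s + s ≫ s ≫ s ≫ s - s ≫ s ≫ s - s ≫ s ≫ s ≫ s ≫ s -
      s ≫ s ≫ s ≫ s ≫ s ≫ s) :
    t ≫ η = η ≫ t := by
  subst hη
  simp only [Preadditive.add_comp, Preadditive.comp_add, Preadditive.sub_comp, Preadditive.comp_sub,
    Category.assoc, hst, reassoc_of% hst, h7, Category.comp_id]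
  abel

end FrobeniusTwentyOne

/-! ### On the Jacobian and on the Prym `B = (ker e_N)⁰`: the restrictions `t_B`, `φ'` exist and `φ'² = -7` -/

section HeckePrym

variable {J : AbelianVariety ℂ} {s t eN : J ⟶ J}

/-- **The restriction `t_B` exists** (the binder `tB` of the fact is instantiable): for `s⁷ = 𝟙` and
`s ≫ t = t ≫ s ≫ s`, `t` commutes with `e_N = Σ_{i<7} sⁱ`, so it restricts to `B = (ker e_N)⁰`
(`AbelianVariety.kerComponentRestrict`). [folklore] -/
theorem exists_kerComponent_restrict_of_conj (h7 : s ≫ s ≫ s ≫ s ≫ s ≫ s ≫ s = 𝟙 J)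
    (hst : s ≫ t = t ≫ s ≫ s)
    (heN : eN = 𝟙 J + s + s ≫ s + s ≫ s ≫ s + s ≫ s ≫ s ≫ s + s ≫ s ≫ s ≫ s ≫ s +
      s ≫ s ≫ s ≫ s ≫ s ≫ s) :
    ∃ tB : AbelianVariety.kerComponent eN ⟶ AbelianVariety.kerComponent eN,
      tB ≫ AbelianVariety.kerComponentι eN = AbelianVariety.kerComponentι eN ≫ t :=
  ⟨AbelianVariety.kerComponentRestrict eN t t (normElement_comm_of_conj h7 hst heN),
    AbelianVariety.kerComponentRestrict_ι eN t t _⟩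

/-- **Restrictions inherit the conjugation relation**: if `s_B`, `t_B` lie over `s`, `t`
(`s_B ≫ ι = ι ≫ s`, `t_B ≫ ι = ι ≫ t`, `ι : B ↪ J` the monomorphism `kerComponentι`) and
`s ≫ t = t ≫ s ≫ s`, then `s_B ≫ t_B = t_B ≫ s_B ≫ s_B`: `F₂₁` acts on `B`. [folklore] -/
theorem kerComponent_restrict_conj (hst : s ≫ t = t ≫ s ≫ s)
    {sB tB : AbelianVariety.kerComponent eN ⟶ AbelianVariety.kerComponent eN}
    (hsB : sB ≫ AbelianVariety.kerComponentι eN = AbelianVariety.kerComponentι eN ≫ s)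
    (htB : tB ≫ AbelianVariety.kerComponentι eN = AbelianVariety.kerComponentι eN ≫ t) :
    sB ≫ tB = tB ≫ sB ≫ sB := by
  rw [← cancel_mono (AbelianVariety.kerComponentι eN), Category.assoc, htB, reassoc_of% hsB, hst,
    Category.assoc, Category.assoc, hsB, reassoc_of% hsB, reassoc_of% htB]

/-- **The Hecke element `η_B` commutes with `t_B`** on `B = (ker e_N)⁰`: `s_B⁷ = 𝟙`
(`kerComponent_restrict_comp_pow_seven`: `Φ₇(s_B) = 0` since `ι ≫ e_N = 0`) and
`s_B ≫ t_B = t_B ≫ s_B ≫ s_B`, so `weilOperator_comm_of_conj` applies in `AbelianVariety ℂ`.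
[cite: LangeRodriguez2022, §2.10 and §3.5 (PDF p. 70)] -/
theorem kerComponent_weilOperator_comm_of_conj (hst : s ≫ t = t ≫ s ≫ s)
    (heN : eN = 𝟙 J + s + s ≫ s + s ≫ s ≫ s + s ≫ s ≫ s ≫ s + s ≫ s ≫ s ≫ s ≫ s +
      s ≫ s ≫ s ≫ s ≫ s ≫ s)
    {sB tB η : AbelianVariety.kerComponent eN ⟶ AbelianVariety.kerComponent eN}
    (hsB : sB ≫ AbelianVariety.kerComponentι eN = AbelianVariety.kerComponentι eN ≫ s)
    (htB : tB ≫ AbelianVariety.kerComponentι eN = AbelianVariety.kerComponentι eN ≫ t)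
    (hη : η = sB + sB ≫ sB + sB ≫ sB ≫ sB ≫ sB - sB ≫ sB ≫ sB - sB ≫ sB ≫ sB ≫ sB ≫ sB -
      sB ≫ sB ≫ sB ≫ sB ≫ sB ≫ sB) :
    tB ≫ η = η ≫ tB :=
  weilOperator_comm_of_conj (kerComponent_restrict_comp_pow_seven heN hsB)
    (kerComponent_restrict_conj hst hsB htB) hη

/-- `η_B` commutes with `𝟙_B - t_B`, the endomorphism whose kernel component is
`P' = (B^{τ})⁰`. [folklore] -/
theorem kerComponent_weilOperator_comm_id_sub_of_conj (hst : s ≫ t = t ≫ s ≫ s)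
    (heN : eN = 𝟙 J + s + s ≫ s + s ≫ s ≫ s + s ≫ s ≫ s ≫ s + s ≫ s ≫ s ≫ s ≫ s +
      s ≫ s ≫ s ≫ s ≫ s ≫ s)
    {sB tB η : AbelianVariety.kerComponent eN ⟶ AbelianVariety.kerComponent eN}
    (hsB : sB ≫ AbelianVariety.kerComponentι eN = AbelianVariety.kerComponentι eN ≫ s)
    (htB : tB ≫ AbelianVariety.kerComponentι eN = AbelianVariety.kerComponentι eN ≫ t)
    (hη : η = sB + sB ≫ sB + sB ≫ sB ≫ sB ≫ sB - sB ≫ sB ≫ sB - sB ≫ sB ≫ sB ≫ sB ≫ sB -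
      sB ≫ sB ≫ sB ≫ sB ≫ sB ≫ sB) :
    η ≫ (𝟙 _ - tB) = (𝟙 _ - tB) ≫ η := by
  rw [Preadditive.comp_sub, Preadditive.sub_comp, Category.comp_id, Category.id_comp,
    kerComponent_weilOperator_comm_of_conj hst heN hsB htB hη]

/-- **The Hecke operator `φ'` on `P' = (ker(𝟙_B - t_B))⁰` exists** (the binder `φ'` of the fact is
instantiable): `η_B` commutes with `𝟙_B - t_B`, so it restricts along `ι' : P' ↪ B`
(`AbelianVariety.kerComponentRestrict`), `φ' ≫ ι' = ι' ≫ η_B`. This is the action of the Hecke algebra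
`p_H ℚ[G] p_H`, `H = ⟨τ⟩`, on the Prym of the intermediate cover `C/⟨τ⟩ → C/F₂₁` up to isogeny
([LangeRodriguez2022, §2.10, §3.5 Cor. 3.5.9]). [cite: LangeRodriguez2022, §2.10 and §3.5 Cor. 3.5.9 (PDF p. 70)] -/
theorem exists_heckeOperator_restrict (hst : s ≫ t = t ≫ s ≫ s)
    (heN : eN = 𝟙 J + s + s ≫ s + s ≫ s ≫ s + s ≫ s ≫ s ≫ s + s ≫ s ≫ s ≫ s ≫ s +
      s ≫ s ≫ s ≫ s ≫ s ≫ s)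
    {sB tB : AbelianVariety.kerComponent eN ⟶ AbelianVariety.kerComponent eN}
    (hsB : sB ≫ AbelianVariety.kerComponentι eN = AbelianVariety.kerComponentι eN ≫ s)
    (htB : tB ≫ AbelianVariety.kerComponentι eN = AbelianVariety.kerComponentι eN ≫ t) :
    ∃ φ' : AbelianVariety.kerComponent (𝟙 (AbelianVariety.kerComponent eN) - tB) ⟶
        AbelianVariety.kerComponent (𝟙 (AbelianVariety.kerComponent eN) - tB),
      φ' ≫ AbelianVariety.kerComponentι (𝟙 (AbelianVariety.kerComponent eN) - tB) =
        AbelianVariety.kerComponentι (𝟙 (AbelianVariety.kerComponent eN) - tB) ≫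
          (sB + sB ≫ sB + sB ≫ sB ≫ sB ≫ sB - sB ≫ sB ≫ sB - sB ≫ sB ≫ sB ≫ sB ≫ sB -
            sB ≫ sB ≫ sB ≫ sB ≫ sB ≫ sB) :=
  ⟨AbelianVariety.kerComponentRestrict _ _ _
      (kerComponent_weilOperator_comm_id_sub_of_conj hst heN hsB htB rfl),
    AbelianVariety.kerComponentRestrict_ι _ _ _ _⟩

/-- **`φ' ∘ φ' = -7`** for EVERY endomorphism `φ'` of `P' = (ker(𝟙_B - t_B))⁰` lying over the Hecke
element `η_B = s_B + s_B² + s_B⁴ - s_B³ - s_B⁵ - s_B⁶` (`φ' ≫ ι' = ι' ≫ η_B`): `η_B ≫ η_B = -7`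
(`kerComponent_weilOperator_comp_self_of_cyclotomic₇`, the quadratic Gauss sum
`(ζ + ζ² + ζ⁴ - ζ³ - ζ⁵ - ζ⁶)² = -7`, i.e. `ℤ[√-7] ⊂ ℤ[ζ₇]` acting on the cyclic Prym, Schoen 1988 §3)
and `ι'` is a monomorphism: `ℚ(φ') = ℚ(√-7)` acts on the Hecke–Prym. [cite: Schoen1988HodgeWeil, §3 (p. 24)]
[cite: LangeRodriguez2022, §3.5 Cor. 3.5.9–3.5.10 (PDF pp. 70–71)] -/
theorem heckeOperator_restrict_comp_self
    (heN : eN = 𝟙 J + s + s ≫ s + s ≫ s ≫ s + s ≫ s ≫ s ≫ s + s ≫ s ≫ s ≫ s ≫ s +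
      s ≫ s ≫ s ≫ s ≫ s ≫ s)
    {sB tB : AbelianVariety.kerComponent eN ⟶ AbelianVariety.kerComponent eN}
    (hsB : sB ≫ AbelianVariety.kerComponentι eN = AbelianVariety.kerComponentι eN ≫ s)
    {φ' : AbelianVariety.kerComponent (𝟙 (AbelianVariety.kerComponent eN) - tB) ⟶
        AbelianVariety.kerComponent (𝟙 (AbelianVariety.kerComponent eN) - tB)}
    (hφ' : φ' ≫ AbelianVariety.kerComponentι (𝟙 (AbelianVariety.kerComponent eN) - tB) =
        AbelianVariety.kerComponentι (𝟙 (AbelianVariety.kerComponent eN) - tB) ≫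
          (sB + sB ≫ sB + sB ≫ sB ≫ sB ≫ sB - sB ≫ sB ≫ sB - sB ≫ sB ≫ sB ≫ sB ≫ sB -
            sB ≫ sB ≫ sB ≫ sB ≫ sB ≫ sB)) :
    φ' ≫ φ' = -((7 : ℤ) • 𝟙 (AbelianVariety.kerComponent (𝟙 (AbelianVariety.kerComponent eN) - tB))) := by
  have hη := kerComponent_weilOperator_comp_self_of_cyclotomic₇ heN hsB (η := _) rfl
  rw [← cancel_mono (AbelianVariety.kerComponentι (𝟙 (AbelianVariety.kerComponent eN) - tB)),
    Category.assoc, hφ', reassoc_of% hφ', hη, Preadditive.neg_comp, Preadditive.comp_neg,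
    Preadditive.zsmul_comp, Preadditive.comp_zsmul, Category.id_comp, Category.comp_id]

/-- **The restriction data of `exists_heckePrymDatum_F21` exist and satisfy `φ'² = -7`, for ANY
complex curve with automorphisms `σ`, `τ`, `σ⁷ = 𝟙`, `σ ≫ τ = τ ≫ σ ≫ σ`, and any Jacobian**: the
endomorphisms `s = σ_*`, `t = τ_*`, `e_N = Σ_{i<7} sⁱ`, restrictions `s_B`, `t_B` to
`B = (ker e_N)⁰`, and `φ'` on `P' = (ker(𝟙_B - t_B))⁰` over the Hecke element, with all the
defining equations of the fact and `φ' ≫ φ' = -7`. This is the Hecke-algebra half of the fact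
([LangeRodriguez2022, §2.10, §3.5 Cor. 3.5.9–3.5.10]); what it leaves is geometric (existence of
the `F₂₁`-curve and its Jacobian, `dim P' = 12`, the Weil class).
[cite: LangeRodriguez2022, §2.10 and §3.5 Cor. 3.5.9–3.5.10 (PDF pp. 47–49, 70–71)] -/
theorem exists_heckePrym_restrictionData {C : SchemeOver ℂ} (𝒥 : Jacobian C) {σ τ : C ⟶ C}
    (hσ : σ ≫ σ ≫ σ ≫ σ ≫ σ ≫ σ ≫ σ = 𝟙 C) (hστ : σ ≫ τ = τ ≫ σ ≫ σ) :
    ∃ (s t eN : 𝒥.J ⟶ 𝒥.J)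
      (sB tB : AbelianVariety.kerComponent eN ⟶ AbelianVariety.kerComponent eN)
      (φ' : AbelianVariety.kerComponent (𝟙 (AbelianVariety.kerComponent eN) - tB) ⟶
        AbelianVariety.kerComponent (𝟙 (AbelianVariety.kerComponent eN) - tB)),
      s = 𝒥.pushforward 𝒥 σ ∧ t = 𝒥.pushforward 𝒥 τ ∧
      eN = 𝟙 𝒥.J + s + s ≫ s + s ≫ s ≫ s + s ≫ s ≫ s ≫ s + s ≫ s ≫ s ≫ s ≫ s +
        s ≫ s ≫ s ≫ s ≫ s ≫ s ∧
      sB ≫ AbelianVariety.kerComponentι eN = AbelianVariety.kerComponentι eN ≫ s ∧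
      tB ≫ AbelianVariety.kerComponentι eN = AbelianVariety.kerComponentι eN ≫ t ∧
      φ' ≫ AbelianVariety.kerComponentι (𝟙 (AbelianVariety.kerComponent eN) - tB) =
        AbelianVariety.kerComponentι (𝟙 (AbelianVariety.kerComponent eN) - tB) ≫
          (sB + sB ≫ sB + sB ≫ sB ≫ sB ≫ sB - sB ≫ sB ≫ sB - sB ≫ sB ≫ sB ≫ sB ≫ sB -
            sB ≫ sB ≫ sB ≫ sB ≫ sB ≫ sB) ∧
      φ' ≫ φ' = -((7 : ℤ) • 𝟙 (AbelianVariety.kerComponent (𝟙 (AbelianVariety.kerComponent eN) - tB))) := by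
  set s : 𝒥.J ⟶ 𝒥.J := 𝒥.pushforward 𝒥 σ with hs
  set t : 𝒥.J ⟶ 𝒥.J := 𝒥.pushforward 𝒥 τ with ht
  set eN : 𝒥.J ⟶ 𝒥.J := 𝟙 𝒥.J + s + s ≫ s + s ≫ s ≫ s + s ≫ s ≫ s ≫ s + s ≫ s ≫ s ≫ s ≫ s +
    s ≫ s ≫ s ≫ s ≫ s ≫ s with heN
  have h7 : s ≫ s ≫ s ≫ s ≫ s ≫ s ≫ s = 𝟙 𝒥.J := pushforward_comp_pow_seven_of_pow_seven 𝒥 hσ hs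
  -- `σ_* ≫ τ_* = τ_* ≫ σ_* ≫ σ_*`: Albanese functoriality of the norm map (Lange 2023, §4.5.2;
  -- the summit-side helper `…IsotypicHeckePrymPlaneLemmas.pushforward_rel` is the same two lines)
  have hst : s ≫ t = t ≫ s ≫ s := by
    simp only [hs, ht, ← Jacobian.pushforward_comp, hστ]
  obtain ⟨sB, hsB⟩ := exists_kerComponent_restrict_pushforward 𝒥 hσ hs heN
  obtain ⟨tB, htB⟩ := exists_kerComponent_restrict_of_conj h7 hst heN
  obtain ⟨φ', hφ'⟩ := exists_heckeOperator_restrict hst heN hsB htB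
  exact ⟨s, t, eN, sB, tB, φ', hs, ht, heN, hsB, htB, hφ', heckeOperator_restrict_comp_self heN hsB hφ'⟩

end HeckePrym

/-! ### Assembly modulo geometry -/

/-- **`exists_heckePrymDatum_F21` from its geometric conjuncts alone.**  If there is a smooth projective
complex curve `C` with a Jacobian `𝒥` of dimension `43` and fixed-point-free automorphisms `σ`, `τ` with
`σ⁷ = 𝟙`, `τ³ = 𝟙`, `σ ≫ τ = τ ≫ σ ≫ σ` (an étale `F₂₁`-cover of a genus-3 curve: Riemann's existence
theorem, [LangeRodriguez2022, Thm. 3.1.1] with the generating vector `(a₁, a₂, a₃; b₁, b₂, b₃) =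
(σ, τ, 1; 1, 1, 1)` of type `(3; —)`, and Milne's existence of Jacobians), such that — for the
endomorphisms `s = σ_*`, `t = τ_*`, `e_N = Σ_{i<7} sⁱ` and ANY restrictions `s_B`, `t_B` to
`B = (ker e_N)⁰` — the fixed component `P' = (ker(𝟙_B - t_B))⁰` has dimension `12` (Chevalley–Weil,
[LangeRodriguez2022, §3.5 Cor. 3.5.9–3.5.10]: `H¹(P') = H¹(B)^τ`, `24`-dimensional) and carries, for
ANY `φ'` over the Hecke element `η_B`, a non-zero rational `(6,6)`-class in the single-operator Weil
plane `Eig((𝟙+φ')^*, (1+i√7)¹²) ⊔ Eig((𝟙+φ')^*, (1-i√7)¹²)` ([vanGeemen1994HodgeAV, Lemma 5.2]: Weil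
type `(6,6)`), THEN the named fact holds: the restriction data exist and `φ' ≫ φ' = -7` by
`exists_heckePrym_restrictionData`.  The hypothesis is the tree-side residue of the fact (no Riemann
existence theorem, no Jacobian of a given curve, no Hodge decomposition of `H¹(P')` in the tree).
[cite: LangeRodriguez2022, Thm. 3.1.1 (PDF p. 52), §3.2 (3.5)–(3.6) (PDF p. 56) and §3.5 Cor. 3.5.9–3.5.10 (PDF pp. 70–71)] -/
theorem exists_heckePrymDatum_F21_of_geometry
    (h : ∃ (C : SchemeOver ℂ) (𝒥 : Jacobian C) (σ τ : C ⟶ C),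
      IsSmoothProjective 1 C ∧ 𝒥.J.dim = 43 ∧
      σ ≫ σ ≫ σ ≫ σ ≫ σ ≫ σ ≫ σ = 𝟙 C ∧ τ ≫ τ ≫ τ = 𝟙 C ∧ σ ≫ τ = τ ≫ σ ≫ σ ∧
      (∀ P : ComplexPoints C, P ≫ σ ≠ P ∧ P ≫ τ ≠ P) ∧
      ∀ (s t eN : 𝒥.J ⟶ 𝒥.J), s = 𝒥.pushforward 𝒥 σ → t = 𝒥.pushforward 𝒥 τ →
        eN = 𝟙 𝒥.J + s + s ≫ s + s ≫ s ≫ s + s ≫ s ≫ s ≫ s + s ≫ s ≫ s ≫ s ≫ s +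
          s ≫ s ≫ s ≫ s ≫ s ≫ s →
      ∀ (sB tB : AbelianVariety.kerComponent eN ⟶ AbelianVariety.kerComponent eN),
        sB ≫ AbelianVariety.kerComponentι eN = AbelianVariety.kerComponentι eN ≫ s →
        tB ≫ AbelianVariety.kerComponentι eN = AbelianVariety.kerComponentι eN ≫ t →
      (AbelianVariety.kerComponent (𝟙 (AbelianVariety.kerComponent eN) - tB)).dim = 12 ∧
      ∀ φ' : AbelianVariety.kerComponent (𝟙 (AbelianVariety.kerComponent eN) - tB) ⟶
          AbelianVariety.kerComponent (𝟙 (AbelianVariety.kerComponent eN) - tB),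
        φ' ≫ AbelianVariety.kerComponentι (𝟙 (AbelianVariety.kerComponent eN) - tB) =
          AbelianVariety.kerComponentι (𝟙 (AbelianVariety.kerComponent eN) - tB) ≫
            (sB + sB ≫ sB + sB ≫ sB ≫ sB ≫ sB - sB ≫ sB ≫ sB - sB ≫ sB ≫ sB ≫ sB ≫ sB -
              sB ≫ sB ≫ sB ≫ sB ≫ sB ≫ sB) →
        ∃ c : complexBetti (AbelianVariety.kerComponent (𝟙 (AbelianVariety.kerComponent eN) - tB)).X 12,
          c ≠ 0 ∧ IsRationalClass c ∧
          IsOfHodgeType 12 (AbelianVariety.kerComponent (𝟙 (AbelianVariety.kerComponent eN) - tB)).X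
            12 6 6 c ∧
          c ∈ Module.End.eigenspace (complexBetti.map
                  (𝟙 (AbelianVariety.kerComponent (𝟙 (AbelianVariety.kerComponent eN) - tB)) +
                    φ').hom.hom.hom 12).hom ((1 + Complex.I * (Real.sqrt (7 : ℝ) : ℂ)) ^ 12) ⊔
              Module.End.eigenspace (complexBetti.map
                  (𝟙 (AbelianVariety.kerComponent (𝟙 (AbelianVariety.kerComponent eN) - tB)) +
                    φ').hom.hom.hom 12).hom ((1 - Complex.I * (Real.sqrt (7 : ℝ) : ℂ)) ^ 12)) :
    exists_heckePrymDatum_F21 := by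
  obtain ⟨C, 𝒥, σ, τ, hC, hdim, hσ, hτ, hστ, hfree, hgeo⟩ := h
  obtain ⟨s, t, eN, sB, tB, φ', hs, ht, heN, hsB, htB, hφ', hsq⟩ :=
    exists_heckePrym_restrictionData 𝒥 hσ hστ
  obtain ⟨hdimP, hweil⟩ := hgeo s t eN hs ht heN sB tB hsB htB
  obtain ⟨c, hc0, hcrat, hctype, hcmem⟩ := hweil φ' hφ'
  exact ⟨C, 𝒥, σ, τ, s, t, eN, sB, tB, φ', hC, hdim, hσ, hτ, hστ, hfree, hs, ht, heN, hsB, htB, hφ',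
    hdimP, hsq, c, hc0, hcrat, hctype, hcmem⟩

end Literature.AlgebraicGeometry.HodgeTheory
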